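import Mathlib
import Summits.Ventures.HodgeRepro2.T6N42HypFlath

/-!
# T6N42FlathMain — the local components of an admissible irreducible `W` are irreducible and
SMOOTH: the corollary of the two displays of `T6N42HypFlath.lean` that feeds the N4.2 residual
`hIS` on the host (owner t6-p5)

`components_of_displays`: under `Hyp.GetzHahn2024_Thm5_7_1 S` and `Hyp.GetzHahn2024_Sec5_7_Note S`,
an admissible irreducible `S.ρ` factors through a family `(W_v)_v` whose members are admissible and
irreducible, hence (Definition 5.4, first clause) SMOOTH and irreducible — the conjunction
`FinitePlacesDatum.IrreducibleSmooth` asks of `π₀,v` at every finite place, once the host `d42`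
takes `π₀,v := W_v` (the choice is the host construction's, `T6N42HostDatum`, not this file's).
Proof lane: projections and `Classical.choose` only; no display, no new object.

README §8(d): uses an L-value-free non-vanishing device: NO (TIER5 §N4.2, a pre-02:16Z line of
record, continued).

Filed in Tier-6 WAVE 1 as p437799 (proposed 2026-08-26T10:23:16Z, ACCEPTED, commit 02a7dbb99626);
this v2 differs from the filed bytes in this module docstring only (the staged-record wording
dropped; every declaration byte-identical to v1).
-/

namespace Summit.Ventures.HodgeRepro2.T6.N42Flath.FactorizationShape

open Summit.Ventures.HodgeRepro2
open Summit.Ventures.HodgeRepro2.T6.N42Flath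

variable (S : FactorizationShape)

/-- The components are smooth and irreducible: the N4.2 reading («`π₀,v` irreducible and smooth at
every finite place») of `LocalAdmissibleIrreducible`. -/
def LocalIrreducibleSmooth (Wv : ∀ v, LocalRep (S.G v)) : Prop :=
  ∀ v, (Wv v).ρ.IsIrreducible ∧ LevelPositivity.IsSmooth (Wv v).ρ

/-- Admissible irreducible components are irreducible and smooth (Definition 5.4, first clause). -/
theorem localIrreducibleSmooth_of_localAdmissibleIrreducible {Wv : ∀ v, LocalRep (S.G v)}
    (h : S.LocalAdmissibleIrreducible Wv) : S.LocalIrreducibleSmooth Wv :=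
  fun v => ⟨(h v).2, (h v).1.isSmooth⟩

/-- THE COROLLARY OF THE TWO DISPLAYS: an admissible irreducible `W` factors through a family of local
representations each of which is admissible and irreducible (Theorem 5.7.1 + the §5.7 note, «only
if» direction). -/
theorem exists_components_of_displays (h₁ : Hyp.GetzHahn2024_Thm5_7_1 S)
    (h₂ : Hyp.GetzHahn2024_Sec5_7_Note S) (hW : S.AdmissibleIrreducible) :
    ∃ Wv : ∀ v, LocalRep (S.G v), S.Factorizable Wv ∧ S.LocalAdmissibleIrreducible Wv := by
  obtain ⟨Wv, hWv⟩ := h₁ hW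
  exact ⟨Wv, hWv, (h₂ Wv hWv).1 hW⟩

/-- The same, with the components read as irreducible and SMOOTH — the shape of `hIS`. -/
theorem exists_components_irreducibleSmooth (h₁ : Hyp.GetzHahn2024_Thm5_7_1 S)
    (h₂ : Hyp.GetzHahn2024_Sec5_7_Note S) (hW : S.AdmissibleIrreducible) :
    ∃ Wv : ∀ v, LocalRep (S.G v), S.Factorizable Wv ∧ S.LocalIrreducibleSmooth Wv := by
  obtain ⟨Wv, hF, hWv⟩ := S.exists_components_of_displays h₁ h₂ hW
  exact ⟨Wv, hF, S.localIrreducibleSmooth_of_localAdmissibleIrreducible hWv⟩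

/-- A CHOICE of components for an admissible irreducible `W` under the displays (the host `d42`
takes `π₀,v := components … v`). -/
noncomputable def components (h₁ : Hyp.GetzHahn2024_Thm5_7_1 S)
    (h₂ : Hyp.GetzHahn2024_Sec5_7_Note S) (hW : S.AdmissibleIrreducible) :
    ∀ v, LocalRep (S.G v) :=
  Classical.choose (S.exists_components_irreducibleSmooth h₁ h₂ hW)

/-- `W` factors through the chosen components. -/
theorem factorizable_components (h₁ : Hyp.GetzHahn2024_Thm5_7_1 S)
    (h₂ : Hyp.GetzHahn2024_Sec5_7_Note S) (hW : S.AdmissibleIrreducible) :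
    S.Factorizable (S.components h₁ h₂ hW) :=
  (Classical.choose_spec (S.exists_components_irreducibleSmooth h₁ h₂ hW)).1

/-- The chosen components are irreducible and smooth at every place — `hIS` for them. -/
theorem components_irreducibleSmooth (h₁ : Hyp.GetzHahn2024_Thm5_7_1 S)
    (h₂ : Hyp.GetzHahn2024_Sec5_7_Note S) (hW : S.AdmissibleIrreducible) :
    S.LocalIrreducibleSmooth (S.components h₁ h₂ hW) :=
  (Classical.choose_spec (S.exists_components_irreducibleSmooth h₁ h₂ hW)).2

/-- Irreducibility of every chosen component. -/
theorem components_irreducible (h₁ : Hyp.GetzHahn2024_Thm5_7_1 S)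
    (h₂ : Hyp.GetzHahn2024_Sec5_7_Note S) (hW : S.AdmissibleIrreducible) (v : S.Place) :
    (S.components h₁ h₂ hW v).ρ.IsIrreducible :=
  (S.components_irreducibleSmooth h₁ h₂ hW v).1

/-- Smoothness of every chosen component. -/
theorem components_smooth (h₁ : Hyp.GetzHahn2024_Thm5_7_1 S)
    (h₂ : Hyp.GetzHahn2024_Sec5_7_Note S) (hW : S.AdmissibleIrreducible) (v : S.Place) :
    LevelPositivity.IsSmooth (S.components h₁ h₂ hW v).ρ :=
  (S.components_irreducibleSmooth h₁ h₂ hW v).2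

end Summit.Ventures.HodgeRepro2.T6.N42Flath.FactorizationShape
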